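import Mathlib
import Summits.ResolutionOfSingularities.ResolutionOfSingularities.Theorems.PAlterationPicoverLocalModelSingularLocus

/-!
# Crux `PicoverLocalModel` (stmt-ResolutionOfSingularities-0557), line `SketchIdeator3`
# (giraud-cossart-normal-form) — the Kummer twist inside the multiplicative Frobenius class

Helper lemmas of the line (first lemma of the card `giraud-cossart-normal-form`, proved by
ideator 3 in `Cruxes/PicoverLocalModel/SketchIdeator3.lean` and landed here verbatim): if
`a = x^m · u` with `u` a unit and `α p + β m = 1`, then `t ↦ s^m · u^α` is an `R`-algebra map
`R[t]/(t^p - x^m u) → R[s]/(s^p - x u^β)` (both rings are orders of the same degree-`p` purely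
inseparable field; the new radicand `x u^β = a^β (x^α)^p` lies in the multiplicative Frobenius
class of `a`), and the target is regular at every prime over a prime `𝔮 ∋ x` of `R` at which `x`
is transversal (`D x ∉ 𝔮` for some derivation `D`). This is the Kummer/toric exit of the endgame
`stub_logRegularEndgame` at boundary points with a single exponent prime to `p`.
-/

open Polynomial

set_option linter.dupNamespace false

namespace Summit.ResolutionOfSingularities.ResolutionOfSingularities.Theorems.PicoverLocalModel.KummerTwist

/-- Units arithmetic for the twist: `(u^β)^m · (u^α)^p = u` when `α p + β m = 1`. [folklore] -/
theorem units_zpow_key : ∀ {R : Type*} [CommRing R] (p m : ℕ) (u : Rˣ) (α β : ℤ), α * (p : ℤ) + β * (m : ℤ) = 1 → ((u ^ β : Rˣ) : R) ^ m * (((u ^ α : Rˣ) : R)) ^ p = (u : R) := by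
  intro R _ p m u α β hbez
  have h : (u ^ β) ^ (m : ℤ) * (u ^ α) ^ (p : ℤ) = u := by
    rw [← zpow_mul, ← zpow_mul, ← zpow_add]
    have : β * (m : ℤ) + α * (p : ℤ) = 1 := by linarith
    rw [this, zpow_one]
  have h' : ((u ^ β) ^ m * (u ^ α) ^ p : Rˣ) = u := by
    exact_mod_cast h
  have := congrArg (fun w : Rˣ => (w : R)) h'
  simpa [Units.val_mul, Units.val_pow_eq_pow_val] using this

/-- **Kummer twist**: the `R`-algebra map `R[t]/(t^p - x^m u) → R[s]/(s^p - x u^β)`,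
`t ↦ s^m u^α`, for `α p + β m = 1` (`u` a unit). [folklore] -/
theorem exists_kummerTwist : ∀ {R : Type*} [CommRing R] (p m : ℕ) (x : R) (u : Rˣ) (α β : ℤ), α * (p : ℤ) + β * (m : ℤ) = 1 → ∃ φ : AdjoinRoot ((Polynomial.X : Polynomial R) ^ p - Polynomial.C (x ^ m * (u : R))) →ₐ[R] AdjoinRoot ((Polynomial.X : Polynomial R) ^ p - Polynomial.C (x * ((u ^ β : Rˣ) : R))), φ (AdjoinRoot.root _) = AdjoinRoot.root ((Polynomial.X : Polynomial R) ^ p - Polynomial.C (x * ((u ^ β : Rˣ) : R))) ^ m * algebraMap R _ ((u ^ α : Rˣ) : R) := by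
  intro R _ p m x u α β hbez
  set g : R[X] := (X : R[X]) ^ p - C (x * ((u ^ β : Rˣ) : R)) with hg
  set s : AdjoinRoot g := AdjoinRoot.root g with hs
  have hsp : s ^ p = algebraMap R _ (x * ((u ^ β : Rˣ) : R)) := by
    have h0 : aeval s g = 0 := by rw [hs]; exact AdjoinRoot.aeval_eq g ▸ AdjoinRoot.mk_self
    simp only [hg, map_sub, map_pow, aeval_X, aeval_C] at h0
    exact sub_eq_zero.mp h0
  set r : AdjoinRoot g := s ^ m * algebraMap R _ ((u ^ α : Rˣ) : R) with hr
  have hkey : (x * ((u ^ β : Rˣ) : R)) ^ m * (((u ^ α : Rˣ) : R)) ^ p = x ^ m * (u : R) := by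
    rw [mul_pow, mul_assoc, units_zpow_key p m u α β hbez]
  have hroot : ((X : R[X]) ^ p - C (x ^ m * (u : R))).eval₂ (Algebra.ofId R (AdjoinRoot g)) r = 0 := by
    change aeval r ((X : R[X]) ^ p - C (x ^ m * (u : R))) = 0
    simp only [map_sub, map_pow, aeval_X, aeval_C]
    rw [sub_eq_zero, hr, mul_pow, ← pow_mul, mul_comm m p, pow_mul, hsp, ← map_pow, ← map_pow,
      ← map_mul, hkey]
  refine ⟨AdjoinRoot.liftAlgHom _ (Algebra.ofId R _) r hroot, ?_⟩
  rw [AdjoinRoot.liftAlgHom_root]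

/-- **The twisted model is regular over the transversal locus of `x`**: if `x ∈ 𝔮 = P ∩ R` and
some derivation `D` of `R` has `D x ∉ 𝔮`, then `R[s]/(s^p - x v)` is regular at `P` for every
unit `v` (e.g. `v = u^β`) — the landed pointwise transversality criterion
`isRegularLocalRing_localModel_of_derivation` (Stacks 07PF) applied to the radicand `x v`, whose
derivative `v · D x + x · D v` is `≡ v · D x ∉ 𝔮`. [folklore] -/
theorem isRegularLocalRing_kummerTwist_of_derivation : ∀ {R : Type*} [CommRing R] [IsRegularRing R] (p : ℕ) (x : R) (v : Rˣ) (D : Derivation ℤ R R) (P : Ideal (AdjoinRoot ((Polynomial.X : Polynomial R) ^ p - Polynomial.C (x * (v : R))))) [P.IsPrime], x ∈ P.comap (AdjoinRoot.of ((Polynomial.X : Polynomial R) ^ p - Polynomial.C (x * (v : R)))) → D x ∉ P.comap (AdjoinRoot.of ((Polynomial.X : Polynomial R) ^ p - Polynomial.C (x * (v : R)))) → IsRegularLocalRing (Localization.AtPrime P) := by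
  intro R _ _ p x v D P _ hx hD
  refine Summit.ResolutionOfSingularities.ResolutionOfSingularities.Theorems.isRegularLocalRing_localModel_of_derivation
    D (x * (v : R)) p P ?_
  intro hmem
  apply hD
  have hq : (P.comap (AdjoinRoot.of ((X : R[X]) ^ p - C (x * (v : R))))).IsPrime := Ideal.comap_isPrime _ _
  rw [Derivation.leibniz] at hmem
  have hx' : x • D (v : R) ∈ P.comap (AdjoinRoot.of ((X : R[X]) ^ p - C (x * (v : R)))) := by
    rw [smul_eq_mul]
    exact Ideal.mul_mem_right _ _ hx
  have hv : (v : R) • D x ∈ P.comap (AdjoinRoot.of ((X : R[X]) ^ p - C (x * (v : R)))) := by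
    have := Ideal.sub_mem _ hmem hx'
    simpa using this
  rw [smul_eq_mul] at hv
  rcases hq.mem_or_mem hv with h | h
  · exact (hq.ne_top (Ideal.eq_top_of_isUnit_mem _ h (Units.isUnit v))).elim
  · exact h

end Summit.ResolutionOfSingularities.ResolutionOfSingularities.Theorems.PicoverLocalModel.KummerTwist
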